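import Literature.AlgebraicGeometry.Motives.AbelianVarietyTheoremOfCube
import Literature.AlgebraicGeometry.Motives.AbelianVarietyAmpleProofs
import Literature.AlgebraicGeometry.Motives.TheoremOfCubeLocal
import Literature.AlgebraicGeometry.Motives.CartierDivisorClassMap
import HarnessLib

/-!
# The theorem of the square from the triviality of the cube divisor over a dense open of the base

For an abelian variety `A` over a field `K` and a Cartier divisor `D` on `A`, the universal cube
divisor of Görtz–Wedhorn II, Prop. 27.167 / Mumford, *Abelian Varieties*, §6,
`c(D) = m₁₂₃^*D - m₁₂^*D - m₁₃^*D - m₂₃^*D + p₁^*D + p₂^*D + p₃^*D` on `A × A × A`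
(`AbelianVariety.cubeDivisor`, the difference `cubePos - cubeNeg` of `Motives/AbelianVarietyTheoremOfCube`
at the three projections), is viewed as a family of divisor classes on `A × A` parametrised by the
THIRD factor (`AbelianVariety.cubeDivisor'`, transported along the associator to `(A × A) × A`, the
shape used by `CartierDivisor.trivialLocus` and by the local form of the theorem of the cube in this
tree). The theorem of the cube says `c(D) ∼ 0`; its printed proofs (Görtz–Wedhorn II, Thm. 24.73;
Mumford §6) need the trivial locus of this family to be open AND closed, and closedness (the seesaw
theorem, Thm. 24.66 (3)) rests on the finiteness of coherent cohomology of the proper, not yet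
projective, scheme `A × A`.

This file PROVES that for the theorem of the square — and hence for the projectivity of abelian
varieties (`Motives/AbelianVarietyAmpleProofs`: `isProjectiveOver_of_theoremOfTheSquare`) — the
closedness is not needed: **if, for every `D`, the cube divisor `c(D)` is trivial over some non-empty
open subset `V` of the third factor, then the theorem of the square holds for `A`** (over an
algebraically closed field; `AbelianVariety.theoremOfTheSquare_of_isTrivialOver_cubeDivisor'`). The
argument:

* `square_of_isTrivialOver_cubeDivisor'` — for `y ∈ V(K)` and any `x ∈ A(K)`, restricting `c(D)`
  along `a ↦ (x, a, y)`, which lands over `y ∈ V`, gives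
  `t_{xy}^*D + D ∼ t_x^*D + t_y^*D` (the computation of Görtz–Wedhorn II, proof of Thm. 27.168,
  p. 878, at the triple `(x, 𝟙, y)` instead of `(x, y, 𝟙)`);
* `additive_of_forall_mem` — for a map `b : G → Q` from a commutative group to an abelian group the
  set `{y | ∀ x, b(xy) = b(x) + b(y)}` is a subgroup, so it is everything as soon as every element is
  `v₁ v₂⁻¹` with `v₁, v₂` in it; applied to `b(y) = [t_y^*D] - [D]` in a model of the divisor class
  group (`CartierDivisor.exists_classMap`, `Motives/CartierDivisorClassMap`), where
  `b(xy) = b(x) + b(y)` is literally the theorem of the square at `(x, y)`;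
* `exists_eq_mul_inv_of_nonempty` — over `K = K̄` every `y ∈ A(K)` is `v₁ v₂⁻¹` with
  `v₁, v₂ ∈ V(K)`: the open `V ∩ t_{y⁻¹}⁻¹V` of the irreducible `A` is non-empty, hence has a closed,
  i.e. rational, point `v₁` (`Motives/AbelianVarietyAmpleProofs`, `Motives/AbelianVarietyTranslation`).

No named fact is introduced. This is the first step of a cohomology-light route to
`AbelianVariety.isProjectiveOver`: the remaining input, the triviality of `c(D)` over a dense open of
the third factor, follows from Step (I) of Görtz–Wedhorn II, Lemma 24.72 (proved in this tree,
`Motives/CubeStepI`) by descending through the codimension of points of the third factor with a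
lifting argument over discrete valuation rings that only needs finiteness of cohomology on a
PROJECTIVE (Chow) model of `A × A`. Mathlib searched (pin): `nonempty_preirreducible_inter`,
`IrreducibleSpace.isIrreducible_univ`, `CartesianMonoidalCategory.lift_fst`, `lift_snd`,
`associator_inv_snd`/`associator_hom_...` (used via `simp`); Mathlib has no theorem of the square.

## References

* U. Görtz, T. Wedhorn, *Algebraic Geometry II: Cohomology of Schemes*, Springer Spektrum (2023),
  doi:10.1007/978-3-658-43031-3: Prop. 27.167 and Thm. 27.168 with its proof (pp. 877–878);
  Thm. 24.73 and its proof (p. 550). [GortzWedhorn2023]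
* D. Mumford, *Abelian Varieties*, TIFR Studies in Mathematics 5 (1970): §6, Cor. 2 and Cor. 4
  (theorem of the square), pp. 57–59. [MumfordAV1970]
-/

universe u

open CategoryTheory CategoryTheory.Limits AlgebraicGeometry MonoidalCategory
open CartesianMonoidalCategory
open scoped MonObj

noncomputable section

namespace Literature.AlgebraicGeometry.Motives

/-! ### Algebra: maps from a group to an abelian group that are additive along a generating set -/

section Additive

variable {G : Type*} [CommGroup G] {Q : Type*} [AddCommGroup Q] (b : G → Q)

/-- If `b(xy) = b(x) + b(y)` for all `x`, then `b(1) = 0`. [folklore] -/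
theorem map_one_eq_zero_of_forall_mul {y : G} (hy : ∀ x, b (x * y) = b x + b y) : b 1 = 0 := by
  have h := hy 1
  rw [one_mul] at h
  exact (add_eq_right.mp h.symm)

/-- If `b(xy) = b(x) + b(y)` for all `x`, then `b(y⁻¹) = -b(y)`. [folklore] -/
theorem map_inv_eq_neg_of_forall_mul {y : G} (hy : ∀ x, b (x * y) = b x + b y) : b y⁻¹ = -b y := by
  have h := hy y⁻¹
  rw [inv_mul_cancel, map_one_eq_zero_of_forall_mul b hy] at h
  exact (neg_eq_of_add_eq_zero_left h.symm).symm

/-- The set `{y | ∀ x, b(xy) = b(x) + b(y)}` is stable under inversion. [folklore] -/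
theorem forall_mul_inv_of_forall_mul {y : G} (hy : ∀ x, b (x * y) = b x + b y) :
    ∀ x, b (x * y⁻¹) = b x + b y⁻¹ := by
  intro x
  have h := hy (x * y⁻¹)
  rw [inv_mul_cancel_right] at h
  rw [map_inv_eq_neg_of_forall_mul b hy, h, add_neg_cancel_right]

/-- The set `{y | ∀ x, b(xy) = b(x) + b(y)}` is stable under products. [folklore] -/
theorem forall_mul_mul_of_forall_mul {y z : G} (hy : ∀ x, b (x * y) = b x + b y)
    (hz : ∀ x, b (x * z) = b x + b z) : ∀ x, b (x * (y * z)) = b x + b (y * z) := by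
  intro x
  rw [← mul_assoc, hz, hy, hz, add_assoc]

/-- **A map from a commutative group to an abelian group which is additive along a generating set
is additive**: if `b(x v) = b(x) + b(v)` for all `x ∈ G` and all `v` in a subset `S` such that every
element of `G` is of the form `v₁ v₂⁻¹` with `v₁, v₂ ∈ S`, then `b(xy) = b(x) + b(y)` for all `x, y`
(the set of such `y` is a subgroup containing `S`). [folklore] -/
theorem additive_of_forall_mem (S : Set G) (hS : ∀ v ∈ S, ∀ x, b (x * v) = b x + b v)
    (hgen : ∀ y : G, ∃ v₁ ∈ S, ∃ v₂ ∈ S, y = v₁ * v₂⁻¹) (x y : G) :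
    b (x * y) = b x + b y := by
  obtain ⟨v₁, hv₁, v₂, hv₂, rfl⟩ := hgen y
  exact forall_mul_mul_of_forall_mul b (hS v₁ hv₁) (forall_mul_inv_of_forall_mul b (hS v₂ hv₂)) x

end Additive

namespace AbelianVariety

variable {K : Type u} [Field K] (A : AbelianVariety K)

/-! ### The universal cube divisor as a family over the third factor -/

/-- `(A × A) × A` is integral (it is isomorphic to `A × (A × A)` by the associator). [folklore] -/
instance isIntegral_tensor_tensor_left : IsIntegral ((A.X ⊗ A.X) ⊗ A.X).left :=
  IsIntegral.of_isIso (α_ A.X A.X A.X).inv.left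

/-- **The universal cube divisor** `c(D) = cubePos D p₁ p₂ p₃ - cubeNeg D p₁ p₂ p₃` on
`A × (A × A)` (Görtz–Wedhorn II, Prop. 27.167 in the universal case `T = A × A × A`, `xᵢ = pᵢ`;
Mumford, *Abelian Varieties*, §6, Cor. 2: the line bundle
`m₁₂₃^*L ⊗ m₁₂^*L⁻¹ ⊗ m₁₃^*L⁻¹ ⊗ m₂₃^*L⁻¹ ⊗ p₁^*L ⊗ p₂^*L ⊗ p₃^*L`), as a Cartier divisor
presentation. [cite: GortzWedhorn2023, Prop. 27.167 (p. 877)] -/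
def cubeDivisor (D : CartierDivisor A.X.left) : CartierDivisor (A.X ⊗ (A.X ⊗ A.X)).left :=
  cubePos D (CartesianMonoidalCategory.fst A.X (A.X ⊗ A.X))
      (CartesianMonoidalCategory.snd A.X (A.X ⊗ A.X) ≫ CartesianMonoidalCategory.fst A.X A.X)
      (CartesianMonoidalCategory.snd A.X (A.X ⊗ A.X) ≫ CartesianMonoidalCategory.snd A.X A.X) +
    -cubeNeg D (CartesianMonoidalCategory.fst A.X (A.X ⊗ A.X))
      (CartesianMonoidalCategory.snd A.X (A.X ⊗ A.X) ≫ CartesianMonoidalCategory.fst A.X A.X)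
      (CartesianMonoidalCategory.snd A.X (A.X ⊗ A.X) ≫ CartesianMonoidalCategory.snd A.X A.X)

/-- **The universal cube divisor transported to `(A × A) × A`**, i.e. viewed as a family of divisors
on `A × A` parametrised by the third factor (the shape `(X ⊗ Y) ⊗ T` of
`CartierDivisor.trivialLocus` and of Görtz–Wedhorn II, Lemma 24.72 / Thm. 24.73 in this tree).
[cite: GortzWedhorn2023, Thm. 24.73, proof (p. 550)] -/
def cubeDivisor' (D : CartierDivisor A.X.left) : CartierDivisor ((A.X ⊗ A.X) ⊗ A.X).left :=
  (A.cubeDivisor D).classPullback (α_ A.X A.X A.X).hom.left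

variable {A}

/-- The constant map `A → Spec K →P A` takes the value `pt P` everywhere. [folklore] -/
theorem toSpecOver_comp_left_apply (P : A.Points K) (a : A.X.left) :
    (toSpecOver A.X ≫ P).left a = AlgPoints.pt P := by
  haveI : Unique ↥(specOver K K).left := inferInstanceAs (Unique (PrimeSpectrum K))
  change P.left (A.X.hom a) = P.left _
  congr 1
  exact Subsingleton.elim _ _

/-- **The theorem of the square at `(x, y)` from the triviality of the cube divisor over an open
`V ∋ y` of the third factor** (the computation of Görtz–Wedhorn II, proof of Thm. 27.168, p. 878,
run at the triple `(x₁, x₂, x₃) = (x, 𝟙, y)`: the map `a ↦ (x, a, y)`, `A → (A × A) × A`, lands over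
`y ∈ V`, so the class of `c(D)` pulls back to `0` along it
(`CartierDivisor.IsTrivialOver.classPullback_linEquiv_zero`); by functoriality of `cubePos`/`cubeNeg`
this says `cubePos D x 𝟙 y ∼ cubeNeg D x 𝟙 y`, i.e.
`t_{xy}^*D + x^*D + D + y^*D ∼ t_x^*D + (xy)^*D + t_y^*D + 1^*D` with the constant pullbacks
trivial). [cite: GortzWedhorn2023, Thm. 27.168, proof (p. 878)] -/
theorem square_of_isTrivialOver_cubeDivisor' {D : CartierDivisor A.X.left} {V : A.X.left.Opens}
    (hV : (A.cubeDivisor' D).IsTrivialOver (CartesianMonoidalCategory.snd (A.X ⊗ A.X) A.X).left V)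
    (x y : A.Points K) (hy : AlgPoints.pt y ∈ V) :
    (D.pullback (A.translation (x * y)).left + D).LinEquiv
      (D.pullback (A.translation x).left + D.pullback (A.translation y).left) := by
  -- notation
  let p₁ : A.X ⊗ (A.X ⊗ A.X) ⟶ A.X := CartesianMonoidalCategory.fst _ _
  let p₂ : A.X ⊗ (A.X ⊗ A.X) ⟶ A.X :=
    CartesianMonoidalCategory.snd _ _ ≫ CartesianMonoidalCategory.fst _ _
  let p₃ : A.X ⊗ (A.X ⊗ A.X) ⟶ A.X :=
    CartesianMonoidalCategory.snd _ _ ≫ CartesianMonoidalCategory.snd _ _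
  let cx : A.X ⟶ A.X := toSpecOver A.X ≫ x
  let cy : A.X ⟶ A.X := toSpecOver A.X ≫ y
  -- the test map `a ↦ (x, a, y)`
  let s : A.X ⟶ A.X ⊗ (A.X ⊗ A.X) := lift cx (lift (𝟙 A.X) cy)
  let s' : A.X ⟶ (A.X ⊗ A.X) ⊗ A.X := s ≫ (α_ A.X A.X A.X).inv
  have hs's : s' ≫ (α_ A.X A.X A.X).hom = s := by simp [s']
  have hs'3 : s' ≫ CartesianMonoidalCategory.snd (A.X ⊗ A.X) A.X = cy := by simp [s', s, cy]
  have hland : ∀ a : A.X.left,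
      (CartesianMonoidalCategory.snd (A.X ⊗ A.X) A.X).left (s'.left a) ∈ V := by
    intro a
    rw [← Scheme.Hom.comp_apply, ← Over.comp_left, hs'3, toSpecOver_comp_left_apply]
    exact hy
  -- `c(D)` pulls back to `0` along `s`
  have h0 : ((A.cubeDivisor' D).classPullback s'.left).LinEquiv 0 :=
    hV.classPullback_linEquiv_zero s'.left hland
  have h1 : ((A.cubeDivisor D).classPullback s.left).LinEquiv 0 := by
    have h := (A.cubeDivisor D).classPullback_comp_linEquiv (α_ A.X A.X A.X).hom.left s'.left
    rw [← Over.comp_left, hs's] at h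
    exact h.trans h0
  -- hence `cubePos D x 𝟙 y ∼ cubeNeg D x 𝟙 y`
  have h2 : ((cubePos D p₁ p₂ p₃).classPullback s.left).LinEquiv
      ((cubeNeg D p₁ p₂ p₃).classPullback s.left) := by
    apply CartierDivisor.LinEquiv.of_add_neg
    refine ((CartierDivisor.LinEquiv.refl _).add
      (CartierDivisor.classPullback_neg_linEquiv s.left _).symm).trans ?_
    exact (CartierDivisor.classPullback_add_linEquiv s.left _ _).symm.trans h1
  obtain ⟨e1, e2, e3⟩ := A.lift_lift_comp_proj cx (𝟙 A.X) cy
  have hP := cubePos_comp_linEquiv s D p₁ p₂ p₃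
  have hN := cubeNeg_comp_linEquiv s D p₁ p₂ p₃
  simp only [p₁, p₂, p₃] at hP hN h2
  rw [e1, e2, e3] at hP hN
  have hc := (hP.trans h2).trans hN.symm
  -- identify the eight terms
  have exy : cx * cy = toSpecOver A.X ≫ (x * y) := (MonObj.comp_mul _ _ _).symm
  have e4 : cx * 𝟙 A.X * cy = A.translation (x * y) := by
    rw [mul_right_comm, exy]; rfl
  have e5 : cx * 𝟙 A.X = A.translation x := rfl
  have e6 : 𝟙 A.X * cy = A.translation y := by rw [mul_comm]; rfl
  unfold cubePos cubeNeg at hc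
  rw [e4, e5, exy, e6] at hc
  have hZ : ∀ P : A.Points K, (D.classPullback (toSpecOver A.X ≫ P).left).LinEquiv 0 := fun P =>
    CartierDivisor.classPullback_linEquiv_zero_of_const _
      (fun a a' => by rw [toSpecOver_comp_left_apply, toSpecOver_comp_left_apply]) D
  have h1' : (D.classPullback (1 : A.X ⟶ A.X).left).LinEquiv 0 :=
    CartierDivisor.classPullback_linEquiv_zero_of_const _
      (fun a a' => by rw [one_left_apply, one_left_apply]) D
  have hI : (D.classPullback (𝟙 A.X : A.X ⟶ A.X).left).LinEquiv D := D.classPullback_id_linEquiv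
  have hT : ∀ P : A.Points K, (D.classPullback (A.translation P).left).LinEquiv
      (D.pullback (A.translation P).left) := fun P => D.classPullback_linEquiv_pullback _
  -- left-hand side: `t_{xy}^*D + 0 + D + 0 ∼ t_{xy}^*D + D`
  have hL : (D.classPullback (A.translation (x * y)).left + D.classPullback cx.left +
      D.classPullback (𝟙 A.X : A.X ⟶ A.X).left + D.classPullback cy.left).LinEquiv
      (D.pullback (A.translation (x * y)).left + D) :=
    ((((hT _).add (hZ x)).add hI).add (hZ y)).trans
      ((CartierDivisor.add_zero_sameDivisor _).trans
        ((CartierDivisor.add_zero_sameDivisor _).add (CartierDivisor.SameDivisor.refl D))).linEquiv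
  -- right-hand side: `t_x^*D + 0 + t_y^*D + 0 ∼ t_x^*D + t_y^*D`
  have hR : (D.classPullback (A.translation x).left +
      D.classPullback (toSpecOver A.X ≫ (x * y)).left + D.classPullback (A.translation y).left +
      D.classPullback (1 : A.X ⟶ A.X).left).LinEquiv
      (D.pullback (A.translation x).left + D.pullback (A.translation y).left) :=
    ((((hT x).add (hZ _)).add (hT y)).add h1').trans
      ((CartierDivisor.add_zero_sameDivisor _).trans
        ((CartierDivisor.add_zero_sameDivisor _).add (CartierDivisor.SameDivisor.refl _))).linEquiv
  exact (hL.symm.trans hc).trans hR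

/-- **Over an algebraically closed field every rational point is `v₁ v₂⁻¹` with `v₁, v₂` in a given
non-empty open `V`**: the open `V ∩ t_{y⁻¹}⁻¹V` of the irreducible scheme `A` is non-empty, so it
contains a closed point, which is rational (Hilbert's Nullstellensatz, `AbelianVariety.pointOfClosed`);
for such `v₁` put `v₂ = y⁻¹ v₁ ∈ V(K)`. [folklore] -/
theorem exists_eq_mul_inv_of_nonempty [IsAlgClosed K] {V : A.X.left.Opens}
    (hV : (V : Set A.X.left).Nonempty) (y : A.Points K) :
    ∃ v₁ v₂ : A.Points K, AlgPoints.pt v₁ ∈ V ∧ AlgPoints.pt v₂ ∈ V ∧ y = v₁ * v₂⁻¹ := by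
  obtain ⟨v, hv⟩ := hV
  -- `V ∩ t_{y⁻¹}⁻¹ V` is a non-empty open
  have hne : ((V : Set A.X.left) ∩ ((A.translation y⁻¹).left ⁻¹ᵁ V : Set A.X.left)).Nonempty := by
    refine nonempty_preirreducible_inter V.isOpen ((A.translation y⁻¹).left ⁻¹ᵁ V).isOpen ⟨v, hv⟩
      ⟨(A.translation y).left v, ?_⟩
    change (A.translation y⁻¹).left ((A.translation y).left v) ∈ V
    rw [← Scheme.Hom.comp_apply, ← Over.comp_left, translation_comp_translation_inv, Over.id_left]
    exact hv
  obtain ⟨z₀, hz₀c, hz₀⟩ := A.exists_isClosed_mem_of_isOpen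
    (V.isOpen.inter ((A.translation y⁻¹).left ⁻¹ᵁ V).isOpen) hne
  refine ⟨A.pointOfClosed z₀ hz₀c, y⁻¹ * A.pointOfClosed z₀ hz₀c, ?_, ?_, ?_⟩
  · rw [pt_pointOfClosed]; exact hz₀.1
  · rw [← translation_apply_pt, pt_pointOfClosed]; exact hz₀.2
  · rw [mul_inv_rev, inv_inv, mul_inv_cancel_left]

variable (A) in
/-- **The theorem of the square from the triviality of the cube divisor over a dense open of the
third factor.** Let `A` be an abelian variety over an algebraically closed field. If for every
Cartier divisor `D` on `A` the cube divisor `c(D)` on `(A × A) × A` (`AbelianVariety.cubeDivisor'`) is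
trivial over some non-empty open subset of the third factor (`CartierDivisor.IsTrivialOver`), then
the theorem of the square `t_{xy}^*D + D ∼ t_x^*D + t_y^*D` holds for all `x, y ∈ A(K)`
(`AbelianVariety.theoremOfTheSquare`, Görtz–Wedhorn II, Thm. 27.168 / (27.30.2); Mumford §6,
Cor. 4). Proof: in a model `cl : Div(A) → Q` of the divisor class group
(`CartierDivisor.exists_classMap`) put `b(y) = cl(t_y^*D) - cl(D)`; the square at `(x, y)` reads
`b(xy) = b(x) + b(y)`; it holds for `y ∈ V(K)` (`square_of_isTrivialOver_cubeDivisor'`), every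
`y ∈ A(K)` is `v₁v₂⁻¹` with `vᵢ ∈ V(K)` (`exists_eq_mul_inv_of_nonempty`), and the `y` satisfying
it for all `x` form a subgroup (`additive_of_forall_mem`). In particular neither the closedness of
the trivial locus (seesaw, Görtz–Wedhorn II, Thm. 24.66 (3)) nor its openness at every point is
needed for the square. [cite: GortzWedhorn2023, Thm. 27.168 (p. 878)] [cite: MumfordAV1970, §6 Cor. 4 (p. 59)] -/
theorem theoremOfTheSquare_of_isTrivialOver_cubeDivisor' [IsAlgClosed K]
    (H : ∀ D : CartierDivisor A.X.left, ∃ V : A.X.left.Opens, (V : Set A.X.left).Nonempty ∧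
      (A.cubeDivisor' D).IsTrivialOver (CartesianMonoidalCategory.snd (A.X ⊗ A.X) A.X).left V) :
    A.theoremOfTheSquare := by
  intro x y D
  obtain ⟨V, hVne, hV⟩ := H D
  obtain ⟨Q, _, cl, hadd, hiff⟩ := CartierDivisor.exists_classMap A.X.left
  let b : A.Points K → Q := fun P => cl (D.pullback (A.translation P).left) - cl D
  -- the square at `(x', y')` is `b(x'y') = b(x') + b(y')`
  have key : ∀ x' y' : A.Points K,
      (D.pullback (A.translation (x' * y')).left + D).LinEquiv
        (D.pullback (A.translation x').left + D.pullback (A.translation y').left) ↔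
      b (x' * y') = b x' + b y' := by
    intro x' y'
    rw [hiff, hadd, hadd]
    constructor
    · intro h
      calc b (x' * y')
          = (cl (D.pullback (A.translation (x' * y')).left) + cl D) - cl D - cl D := by
            simp only [b]; abel
        _ = (cl (D.pullback (A.translation x').left) + cl (D.pullback (A.translation y').left)) -
              cl D - cl D := by rw [h]
        _ = b x' + b y' := by simp only [b]; abel
    · intro h
      calc cl (D.pullback (A.translation (x' * y')).left) + cl D
          = b (x' * y') + cl D + cl D := by simp only [b]; abel
        _ = b x' + b y' + cl D + cl D := by rw [h]
        _ = cl (D.pullback (A.translation x').left) + cl (D.pullback (A.translation y').left) := by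
            simp only [b]; abel
  rw [key]
  refine additive_of_forall_mem b {P : A.Points K | AlgPoints.pt P ∈ V} (fun v hv x' => ?_)
    (fun y' => ?_) x y
  · exact (key x' v).1 (square_of_isTrivialOver_cubeDivisor' hV x' v hv)
  · obtain ⟨v₁, v₂, h₁, h₂, e⟩ := exists_eq_mul_inv_of_nonempty hVne y'
    exact ⟨v₁, h₁, v₂, h₂, e⟩

end AbelianVariety

end Literature.AlgebraicGeometry.Motives

end
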